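import Literature.Probability.Percolation.MinOpenCutMenger
import Literature.Combinatorics.SimpleGraph.PieceRuns
import HarnessLib

/-!
# Pinned min-cuts through straight cylinders: gluing along a tiling of the base

Topic `Literature/Probability/Percolation`. The deterministic (configuration-wise) half of the
existence of the flow constant through STRAIGHT cylinders in the axis direction (Kesten 1987;
Rossignol–Théret, Ann. IHP 46 (2010), §2.1 and §4.1 — "`τ(A, h)` is not subadditive in `A`, except
for straight cylinders", with the cutsets of the sub-cylinders "patched together" by the edges near
their common boundaries; Dembin 2020, §3 (definition of `τ_p(A, h)`, `C'_1`, `C'_2`) and Lemma 4.1).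

For a corner `a ∈ ℤ^d`, a base side `n` and a height `h`, the straight cylinder is
`scyl a n h = {x : |x₀| ≤ h, aᵢ ≤ xᵢ < aᵢ + n (i ≠ 0)}` (coordinate `0` is the height); its *upper*
(*lower*) *pinned boundary* `upperBdry` (`lowerBdry`) consists of its vertices of positive (negative)
height having a lattice neighbour outside the cylinder (Dembin's `C'_1(A, h)`, `C'_2(A, h)`), and the
*pinned min-cut* `pinnedCut a n h ω = minOpenCutIn (scyl a n h) (lowerBdry …) (upperBdry …) ω` is the
least number of edges whose closing destroys every open path inside the cylinder from the lower to
the upper pinned boundary (`= τ_p(A, h)` for the capacities `𝟙{e open}`, by max-flow = min-cut,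
`MinOpenCutMenger.lean`).

**Gluing theorem** (`pinnedCut_mul_le`). Tile the base of side `k n` by the `k^{d-1}` translates of
the base of side `n`. Then, for every lattice configuration `ω ⊆ E(ℤ^d)`,
`τ(a, kn, h) ≤ Σ_pieces τ(piece) + #cylSeam` (cylSeam = lattice edges at the height-`0` wall vertices):
an open lower-to-upper path avoiding the optimal cutsets of the pieces and the cylSeam has all its
piece-crossing steps horizontal and off height `0`, and the runs lemma (`PieceRuns.lean`) yields a
lower-to-upper crossing of ONE piece avoiding its cutset. Seam cardinality and quasi-monotonicity
in the base: companion file `StraightCylinderCutsBounds.lean`.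
-/

noncomputable section

namespace Literature.Probability.Percolation

open LatticeModels Literature.Combinatorics.SimpleGraph Finset

variable {d : ℕ} [NeZero d]

/-! ### Straight cylinders and their pinned boundaries -/

/-- The base block with corner `a` and side `n`: `aᵢ ≤ xᵢ < aᵢ + n` for the base coordinates
`i ≠ 0` (no condition on the height `x₀`). [cite: Dembin2020, §3 (cyl(A,h))] -/
def cylBase (a : Site d) (n : ℕ) : Set (Site d) :=
  {x | ∀ i : Fin d, i ≠ 0 → a i ≤ x i ∧ x i < a i + n}

/-- The **straight cylinder** `cyl(A, h) ∩ ℤ^d` over the base block of corner `a` and side `n`, of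
height `h`: `|x₀| ≤ h` and `x ∈ cylBase a n`. [cite: Dembin2020, §3 (cyl(A,h))] -/
def scyl (a : Site d) (n h : ℕ) : Set (Site d) := {x | |x 0| ≤ h ∧ x ∈ cylBase a n}

/-- The **upper pinned boundary** `C'_1(A, h)`: vertices of the cylinder of positive height with a
lattice neighbour outside the cylinder. [cite: Dembin2020, §3 (C'_i(A,h))] -/
def upperBdry (a : Site d) (n h : ℕ) : Set (Site d) :=
  {x | x ∈ scyl a n h ∧ 0 < x 0 ∧ ∃ y, y ∉ scyl a n h ∧ (zdGraph d).Adj x y}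

/-- The **lower pinned boundary** `C'_2(A, h)`: vertices of the cylinder of negative height with a
lattice neighbour outside the cylinder. [cite: Dembin2020, §3 (C'_i(A,h))] -/
def lowerBdry (a : Site d) (n h : ℕ) : Set (Site d) :=
  {x | x ∈ scyl a n h ∧ x 0 < 0 ∧ ∃ y, y ∉ scyl a n h ∧ (zdGraph d).Adj x y}

/-- The **pinned min-cut** `τ_p(A, h)` of the straight cylinder for the capacities `𝟙{e open}`: the
least number of edges whose closing leaves no open path inside the cylinder from its lower to its
upper pinned boundary (`minOpenCutIn`; `= ` the maximal number of edge-disjoint such open paths by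
`maxDisjointOpenPathsIn_eq_minOpenCutIn`). [cite: Dembin2020, §3 (definition of τ_p(A,h))] -/
def pinnedCut (a : Site d) (n h : ℕ) (ω : BondConfig (Site d)) : ℕ∞ :=
  minOpenCutIn (scyl a n h) (lowerBdry a n h) (upperBdry a n h) ω

/-- Membership in the straight cylinder. [cite: Dembin2020, §3 (cyl(A,h))] -/
theorem mem_scyl {a : Site d} {n h : ℕ} {x : Site d} :
    x ∈ scyl a n h ↔ |x 0| ≤ h ∧ ∀ i : Fin d, i ≠ 0 → a i ≤ x i ∧ x i < a i + n := Iff.rfl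

/-- The cylinder is finite (it lies in an order interval of `ℤ^d`). [folklore] -/
theorem scyl_finite (a : Site d) (n h : ℕ) : (scyl a n h).Finite := by
  refine (Set.finite_Icc (fun i => if i = 0 then -(h : ℤ) else a i)
    (fun i => if i = 0 then (h : ℤ) else a i + n)).subset ?_
  intro x hx
  obtain ⟨h0, hb⟩ := hx
  refine ⟨fun i => ?_, fun i => ?_⟩
  · by_cases hi : i = 0
    · subst hi; simp only [if_true]; exact (abs_le.1 h0).1
    · simp only [hi, if_false]; exact (hb i hi).1
  · by_cases hi : i = 0
    · subst hi; simp only [if_true]; exact (abs_le.1 h0).2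
    · simp only [hi, if_false]; exact (hb i hi).2.le

/-- Lower and upper pinned boundaries are disjoint (heights of opposite signs). [folklore] -/
theorem lowerBdry_disjoint_upperBdry (a : Site d) (n h : ℕ) {x : Site d}
    (hl : x ∈ lowerBdry a n h) (hu : x ∈ upperBdry a n h) : False := by
  have := hl.2.1; have := hu.2.1; omega

/-- The pinned min-cut is finite (the boundaries do not meet). [folklore] -/
theorem pinnedCut_ne_top (a : Site d) (n h : ℕ) (ω : BondConfig (Site d)) : pinnedCut a n h ω ≠ ⊤ := by
  rw [pinnedCut, Ne, minOpenCutIn_eq_top_iff_of_finite (scyl_finite a n h)]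
  rintro ⟨x, -, hl, hu⟩
  exact lowerBdry_disjoint_upperBdry a n h hl hu

/-! ### Lattice steps -/

omit [NeZero d] in
/-- A lattice step changes exactly one coordinate, by one. [folklore] -/
theorem exists_coord_of_adj {x y : Site d} (hxy : (zdGraph d).Adj x y) :
    ∃ i : Fin d, (y i = x i + 1 ∨ y i = x i - 1) ∧ ∀ i', i' ≠ i → y i' = x i' := by
  obtain ⟨i, h | h⟩ := (zdGraph_adj_iff x y).1 hxy
  · refine ⟨i, Or.inl (by rw [h]; simp), fun i' hi' => by rw [h]; simp [Pi.single_eq_of_ne hi']⟩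
  · refine ⟨i, Or.inr (by rw [h]; simp), fun i' hi' => by rw [h]; simp [Pi.single_eq_of_ne hi']⟩

/-! ### Tiling the base -/

/-- The block index of a vertex along the base coordinate `i`, for blocks of side `n` starting at
`a`: `⌊(xᵢ - aᵢ)/n⌋`. [folklore] -/
def cylTileIdx (a : Site d) (n : ℕ) (x : Site d) : Fin d → ℤ :=
  fun i => if i = 0 then 0 else (x i - a i) / n

/-- The corner of the block of index vector `j`. [folklore] -/
def cylTileCorner (a : Site d) (n : ℕ) (j : Fin d → ℤ) : Site d :=
  fun i => if i = 0 then a i else a i + n * j i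

/-- A vertex lies in the block of its own index vector (`n ≥ 1`). [folklore] -/
theorem mem_cylBase_cylTileCorner {a : Site d} {n : ℕ} (hn : 1 ≤ n) (x : Site d) :
    x ∈ cylBase (cylTileCorner a n (cylTileIdx a n x)) n := by
  intro i hi
  simp only [cylTileCorner, cylTileIdx, hi, if_false]
  have hn0 : (0 : ℤ) < n := by exact_mod_cast hn
  have h1 := Int.emod_add_mul_ediv (x i - a i) n
  have h2 := Int.emod_nonneg (x i - a i) (ne_of_gt hn0)
  have h3 := Int.emod_lt_of_pos (x i - a i) hn0
  constructor <;> linarith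

/-- Hence a vertex of the big cylinder lies in the sub-cylinder of its block. [folklore] -/
theorem mem_scyl_cylTileCorner {a : Site d} {n k h : ℕ} (hn : 1 ≤ n) {x : Site d}
    (hx : x ∈ scyl a (k * n) h) : x ∈ scyl (cylTileCorner a n (cylTileIdx a n x)) n h :=
  ⟨hx.1, mem_cylBase_cylTileCorner hn x⟩

/-- The block index vector of a vertex of the big base has entries in `[0, k)`. [folklore] -/
theorem cylTileIdx_mem {a : Site d} {n k h : ℕ} (hn : 1 ≤ n) {x : Site d} (hx : x ∈ scyl a (k * n) h)
    (i : Fin d) (hi : i ≠ 0) : 0 ≤ cylTileIdx a n x i ∧ cylTileIdx a n x i < k := by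
  simp only [cylTileIdx, hi, if_false]
  have hn0 : (0 : ℤ) < n := by exact_mod_cast hn
  obtain ⟨h1, h2⟩ := hx.2 i hi
  refine ⟨Int.ediv_nonneg (by linarith) hn0.le, ?_⟩
  rw [Int.ediv_lt_iff_lt_mul hn0]
  push_cast at h2
  linarith

/-- The sub-cylinder of a block index vector with entries in `[0, k)` lies in the big cylinder.
[folklore] -/
theorem scyl_cylTileCorner_subset {a : Site d} {n k h : ℕ} {j : Fin d → ℤ}
    (hj : ∀ i, i ≠ 0 → 0 ≤ j i ∧ j i < k) : scyl (cylTileCorner a n j) n h ⊆ scyl a (k * n) h := by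
  intro x hx
  refine ⟨hx.1, fun i hi => ?_⟩
  obtain ⟨h1, h2⟩ := hx.2 i hi
  simp only [cylTileCorner, hi, if_false] at h1 h2
  obtain ⟨hj0, hjk⟩ := hj i hi
  have hn0 : (0 : ℤ) ≤ n := Nat.cast_nonneg n
  have hjk' : j i + 1 ≤ k := hjk
  constructor
  · nlinarith
  · push_cast
    nlinarith

/-- **Crossing steps are horizontal and start at a wall.** If two lattice neighbours have
different block index vectors, then they have the same height, and the residue of the first one
along the changing coordinate is `0` or `n - 1` (it lies on a wall of its block). [folklore] -/
theorem height_eq_of_cylTileIdx_ne {a : Site d} {n : ℕ} (hn : 1 ≤ n) {x y : Site d}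
    (hxy : (zdGraph d).Adj x y) (hne : cylTileIdx a n x ≠ cylTileIdx a n y) :
    x 0 = y 0 ∧ ∃ i : Fin d, i ≠ 0 ∧ ((x i - a i) % n = 0 ∨ (x i - a i) % n = n - 1) := by
  obtain ⟨i, hi, hrest⟩ := exists_coord_of_adj hxy
  have hi0 : i ≠ 0 := by
    intro h
    subst h
    apply hne
    funext i'
    by_cases hi' : i' = 0
    · simp [cylTileIdx, hi']
    · simp only [cylTileIdx, hi', if_false, hrest i' hi']
  refine ⟨(hrest 0 (Ne.symm hi0)).symm, i, hi0, ?_⟩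
  have hn0 : (0 : ℤ) < n := by exact_mod_cast hn
  -- the index changes along `i`
  have hidx : (x i - a i) / n ≠ (y i - a i) / n := by
    intro h
    apply hne
    funext i'
    by_cases hi' : i' = 0
    · simp [cylTileIdx, hi']
    · simp only [cylTileIdx, hi', if_false]
      by_cases hii : i' = i
      · subst hii; exact h
      · rw [hrest i' hii]
  have h1 := Int.emod_add_mul_ediv (x i - a i) n
  have h2 := Int.emod_nonneg (x i - a i) (ne_of_gt hn0)
  have h3 := Int.emod_lt_of_pos (x i - a i) hn0
  have h1' := Int.emod_add_mul_ediv (y i - a i) n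
  have h2' := Int.emod_nonneg (y i - a i) (ne_of_gt hn0)
  have h3' := Int.emod_lt_of_pos (y i - a i) hn0
  rcases hi with hi | hi
  · -- `y i = x i + 1`: the residue of `x` is `n - 1`
    right
    by_contra hr
    apply hidx
    -- both quotients equal: `y i - a i = (x i - a i) + 1` with residue `< n - 1 + 1`
    have hq : (y i - a i) / n = (x i - a i) / n := by
      have : y i - a i = ((x i - a i) % n + 1) + n * ((x i - a i) / n) := by rw [hi]; linarith
      rw [this, Int.add_mul_ediv_left _ _ (ne_of_gt hn0),
        Int.ediv_eq_zero_of_lt (by linarith) (by omega), zero_add]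
    exact hq.symm
  · -- `y i = x i - 1`: the residue of `x` is `0`
    left
    by_contra hr
    apply hidx
    have hq : (y i - a i) / n = (x i - a i) / n := by
      have : y i - a i = ((x i - a i) % n - 1) + n * ((x i - a i) / n) := by rw [hi]; linarith
      rw [this, Int.add_mul_ediv_left _ _ (ne_of_gt hn0),
        Int.ediv_eq_zero_of_lt (by omega) (by linarith), zero_add]
    exact hq.symm

/-- Conversely, a vertex of the block of corner `cylTileCorner a n j` (with `j 0 = 0`) has block index
vector `j`. [folklore] -/
theorem cylTileIdx_eq_of_mem {a : Site d} {n : ℕ} (hn : 1 ≤ n) {j : Fin d → ℤ} (hj0 : j 0 = 0)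
    {x : Site d} (hx : x ∈ cylBase (cylTileCorner a n j) n) : cylTileIdx a n x = j := by
  funext i
  by_cases hi : i = 0
  · subst hi; simp [cylTileIdx, hj0]
  · simp only [cylTileIdx, hi, if_false]
    obtain ⟨h1, h2⟩ := hx i hi
    simp only [cylTileCorner, hi, if_false] at h1 h2
    have hn0 : (0 : ℤ) < n := by exact_mod_cast hn
    have : x i - a i = (x i - a i - n * j i) + n * j i := by ring
    rw [this, Int.add_mul_ediv_left _ _ (ne_of_gt hn0),
      Int.ediv_eq_zero_of_lt (by linarith) (by linarith), zero_add]

/-- The block index vectors of the tiling of the base of side `k n` by blocks of side `n`: `j 0 = 0`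
and `0 ≤ j i < k` for `i ≠ 0`. [folklore] -/
def cylIdxSet (k : ℕ) : Finset (Fin d → ℤ) :=
  Fintype.piFinset fun i : Fin d => if i = 0 then {0} else Finset.Ico (0 : ℤ) k

/-- Membership in `cylIdxSet`. [folklore] -/
theorem mem_cylIdxSet {k : ℕ} {j : Fin d → ℤ} :
    j ∈ cylIdxSet (d := d) k ↔ j 0 = 0 ∧ ∀ i : Fin d, i ≠ 0 → 0 ≤ j i ∧ j i < k := by
  simp only [cylIdxSet, Fintype.mem_piFinset]
  constructor
  · intro h
    refine ⟨by simpa using h 0, fun i hi => ?_⟩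
    have := h i
    rw [if_neg hi, Finset.mem_Ico] at this
    exact this
  · rintro ⟨h0, h⟩ i
    by_cases hi : i = 0
    · subst hi; simpa using h0
    · rw [if_neg hi, Finset.mem_Ico]; exact h i hi

/-- The block index vector of a vertex of the big cylinder belongs to `cylIdxSet`. [folklore] -/
theorem cylTileIdx_mem_idxSet {a : Site d} {n k h : ℕ} (hn : 1 ≤ n) {x : Site d}
    (hx : x ∈ scyl a (k * n) h) : cylTileIdx a n x ∈ cylIdxSet (d := d) k :=
  mem_cylIdxSet.2 ⟨by simp [cylTileIdx], fun i hi => cylTileIdx_mem hn hx i hi⟩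

/-! ### The cylSeam -/

open Classical in
/-- The **cylSeam vertices**: vertices of the big cylinder at height `0` lying on a wall of a block of
the tiling (residue `0` or `n - 1` along some base coordinate). [folklore] -/
def cylSeamVertices (a : Site d) (n k h : ℕ) : Finset (Site d) :=
  (scyl_finite a (k * n) h).toFinset.filter fun x =>
    x 0 = 0 ∧ ∃ i : Fin d, i ≠ 0 ∧ ((x i - a i) % n = 0 ∨ (x i - a i) % n = n - 1)

/-- The **cylSeam**: all lattice edges at the cylSeam vertices. [folklore] -/
def cylSeam (a : Site d) (n k h : ℕ) : Finset (Sym2 (Site d)) :=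
  (cylSeamVertices a n k h).biUnion fun x => (zdGraph d).incidenceFinset x

/-- The cylSeam has at most `2d` edges per cylSeam vertex. [folklore] -/
theorem card_cylSeam_le (a : Site d) (n k h : ℕ) :
    (cylSeam a n k h).card ≤ 2 * d * (cylSeamVertices a n k h).card := by
  calc (cylSeam a n k h).card ≤ ∑ x ∈ cylSeamVertices a n k h, ((zdGraph d).incidenceFinset x).card :=
        Finset.card_biUnion_le
    _ = ∑ _x ∈ cylSeamVertices a n k h, 2 * d := Finset.sum_congr rfl fun x _ => by
        rw [SimpleGraph.card_incidenceFinset_eq_degree, ← SimpleGraph.card_neighborFinset_eq_degree]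
        convert card_neighborFinset_zdGraph_holds (d := d) x
    _ = 2 * d * (cylSeamVertices a n k h).card := by rw [Finset.sum_const, smul_eq_mul, mul_comm]

/-- Edges of an induced walk, pushed to the ambient graph, are edges of the original walk. [folklore] -/
theorem map_val_mem_edges_of_mem_edges_induce {V : Type*} {G : SimpleGraph V} {s : Set V} :
    ∀ {u v : V} (w : G.Walk u v) (hw : ∀ x ∈ w.support, x ∈ s) (e : Sym2 s),
      e ∈ (w.induce s hw).edges → Sym2.map Subtype.val e ∈ w.edges
  | _, _, SimpleGraph.Walk.nil, _, e, he => by simp at he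
  | _, _, SimpleGraph.Walk.cons h w, hw, e, he => by
    rw [SimpleGraph.Walk.induce_cons, SimpleGraph.Walk.edges_cons, List.mem_cons] at he
    rw [SimpleGraph.Walk.edges_cons, List.mem_cons]
    rcases he with rfl | he
    · exact Or.inl rfl
    · exact Or.inr (map_val_mem_edges_of_mem_edges_induce w _ e he)

/-! ### Gluing the cutsets of the pieces -/

/-- **Gluing theorem for pinned min-cuts of a tiled straight cylinder** (the configuration-wise
subadditivity step of the flow constant through straight cylinders, Rossignol–Théret 2010 §4.1;
Dembin 2020 Lemma 4.1, straight case): for a lattice configuration `ω ⊆ E(ℤ^d)` and `n ≥ 1`,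
`τ(a, kn, h) ≤ Σ_{j ∈ cylIdxSet} τ(cylTileCorner a n j, n, h) + #cylSeam` — the optimal cutsets of the
`k^{d-1}` pieces together with the cylSeam (all lattice edges at the height-`0` wall vertices) cut the
big cylinder: an open lower-to-upper path avoiding them would have all its piece-crossing steps
horizontal and off height `0`, and the runs lemma (`exists_run_of_neg_of_pos`) would produce a
lower-to-upper open path of one piece avoiding its cutset.
[cite: Dembin2020, Lemma 4.1 (straight cylinders; cf. Rossignol–Théret 2010 §4.1)] -/
theorem pinnedCut_mul_le (a : Site d) {n : ℕ} (hn : 1 ≤ n) (k h : ℕ) {ω : BondConfig (Site d)}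
    (hω : ω ⊆ (zdGraph d).edgeSet) :
    pinnedCut a (k * n) h ω ≤
      (∑ j ∈ cylIdxSet (d := d) k, pinnedCut (cylTileCorner a n j) n h ω) + ((cylSeam a n k h).card : ℕ∞) := by
  classical
  -- optimal cutsets of the pieces
  choose E hE hcard using fun j : Fin d → ℤ =>
    exists_eq_minOpenCutIn (pinnedCut_ne_top (cylTileCorner a n j) n h ω)
  set big := scyl a (k * n) h with hbig
  set C : Finset (Sym2 (Site d)) := cylSeam a n k h ∪ (cylIdxSet (d := d) k).biUnion E with hC
  -- it suffices that `C` is an open cutset of the big cylinder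
  suffices hcut : IsOpenCutsetIn big (lowerBdry a (k * n) h) (upperBdry a (k * n) h) ω ↑C by
    calc pinnedCut a (k * n) h ω ≤ (C.card : ℕ∞) := minOpenCutIn_le_card hcut
      _ ≤ (((cylSeam a n k h).card + ((cylIdxSet (d := d) k).biUnion E).card : ℕ) : ℕ∞) := by
          exact_mod_cast Finset.card_union_le _ _
      _ ≤ (((cylSeam a n k h).card + ∑ j ∈ cylIdxSet (d := d) k, (E j).card : ℕ) : ℕ∞) := by
          exact_mod_cast Nat.add_le_add_left Finset.card_biUnion_le _
      _ = (∑ j ∈ cylIdxSet (d := d) k, pinnedCut (cylTileCorner a n j) n h ω) + ((cylSeam a n k h).card : ℕ∞) := by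
          push_cast
          rw [add_comm]
          congr 1
          exact Finset.sum_congr rfl fun j _ => hcard j
  -- an open lower-to-upper path of the big cylinder avoiding `C` is impossible
  rw [isOpenCutsetIn_iff_isEdgeCutsetIn_openGraph]
  intro u v hu hv p
  by_contra hcon
  push Not at hcon
  -- crossing steps of `p` are horizontal and off the equator
  have hadjV : ∀ z z' : big, ((openGraph ω).induce big).Adj z z' → (zdGraph d).Adj z.1 z'.1 := by
    intro z z' hzz'
    rw [SimpleGraph.induce_adj, openGraph_adj] at hzz'
    exact hω hzz'.1
  have hcross : ∀ z z' : big, s(z, z') ∈ p.edges → cylTileIdx a n z.1 ≠ cylTileIdx a n z'.1 →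
      z.1 0 = z'.1 0 ∧ z.1 0 ≠ 0 := by
    intro z z' he hne
    have hadj : ((openGraph ω).induce big).Adj z z' := p.adj_of_mem_edges he
    obtain ⟨h0, i, hi, hres⟩ := height_eq_of_cylTileIdx_ne hn (hadjV z z' hadj) hne
    refine ⟨h0, fun hz0 => hcon _ he ?_⟩
    -- `z` is a cylSeam vertex, so the lattice edge `zz'` lies in the cylSeam
    have hzT : z.1 ∈ cylSeamVertices a n k h := by
      rw [cylSeamVertices, Finset.mem_filter, Set.Finite.mem_toFinset]
      exact ⟨z.2, hz0, i, hi, hres⟩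
    rw [Sym2.map_mk, Finset.mem_coe, hC, Finset.mem_union]
    left
    rw [cylSeam, Finset.mem_biUnion]
    refine ⟨z.1, hzT, ?_⟩
    rw [SimpleGraph.mem_incidenceFinset]
    exact ⟨hadjV z z' hadj, Sym2.mem_mk_left _ _⟩
  -- the runs lemma
  obtain ⟨j, α, β, q, hqj, hqe, hα, hβ, hFα, hFβ⟩ :=
    exists_run_of_neg_of_pos (H := (openGraph ω).induce big) (fun z : big => cylTileIdx a n z.1)
      (fun z : big => z.1 0)
      (fun z : big => (∃ y, y ∉ big ∧ (zdGraph d).Adj z.1 y) ∨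
        ∃ z' : big, ((openGraph ω).induce big).Adj z z' ∧ cylTileIdx a n z.1 ≠ cylTileIdx a n z'.1)
      (fun z z' hzz' hne => ⟨Or.inr ⟨z', hzz', hne⟩, Or.inr ⟨z, hzz'.symm, hne.symm⟩⟩)
      p hu.2.1 hv.2.1 (Or.inl hu.2.2) (Or.inl hv.2.2)
      (fun z z' he hne => hcross z z' he hne)
  -- the run lives in the piece `Cj`
  have hj0 : j 0 = 0 := by rw [← hqj α q.start_mem_support]; simp [cylTileIdx]
  have hjmem : j ∈ cylIdxSet (d := d) k := by rw [← hqj α q.start_mem_support]; exact cylTileIdx_mem_idxSet hn α.2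
  set Cj := scyl (cylTileCorner a n j) n h with hCj
  have hsub : Cj ⊆ big := scyl_cylTileCorner_subset fun i hi => ((mem_cylIdxSet.1 hjmem).2 i hi)
  have hmemCj : ∀ z ∈ q.support, (z : Site d) ∈ Cj := fun z hz => by
    have := mem_scyl_cylTileCorner (k := k) hn z.2
    rwa [hqj z hz] at this
  -- frontier vertices of the run are pinned boundary vertices of the piece
  have hbdry : ∀ z ∈ q.support,
      ((∃ y, y ∉ big ∧ (zdGraph d).Adj z.1 y) ∨
        ∃ z' : big, ((openGraph ω).induce big).Adj z z' ∧ cylTileIdx a n z.1 ≠ cylTileIdx a n z'.1) →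
      ∃ y, y ∉ Cj ∧ (zdGraph d).Adj z.1 y := by
    intro z hz hF
    rcases hF with ⟨y, hy, hzy⟩ | ⟨z', hzz', hne⟩
    · exact ⟨y, fun h' => hy (hsub h'), hzy⟩
    · refine ⟨z'.1, fun h' => hne ?_, hadjV z z' hzz'⟩
      rw [hqj z hz, cylTileIdx_eq_of_mem hn hj0 h'.2]
  have hαlo : α.1 ∈ lowerBdry (cylTileCorner a n j) n h :=
    ⟨hmemCj α q.start_mem_support, hα, hbdry α q.start_mem_support hFα⟩
  have hβup : β.1 ∈ upperBdry (cylTileCorner a n j) n h :=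
    ⟨hmemCj β q.end_mem_support, hβ, hbdry β q.end_mem_support hFβ⟩
  -- transport the run to the open graph induced on the piece
  set q₀ := q.map (SimpleGraph.Embedding.induce big).toHom with hq₀
  have hq₀supp : ∀ z ∈ q₀.support, z ∈ Cj := by
    intro z hz
    rw [hq₀, SimpleGraph.Walk.support_map, List.mem_map] at hz
    obtain ⟨z', hz', rfl⟩ := hz
    exact hmemCj z' hz'
  have hq₀edges : ∀ e ∈ q₀.edges, e ∉ (↑(E j) : Set (Sym2 (Site d))) := by
    intro e he heE
    rw [hq₀, SimpleGraph.Walk.edges_map, List.mem_map] at he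
    obtain ⟨e', he', rfl⟩ := he
    refine hcon e' (hqe e' he') ?_
    rw [Finset.mem_coe, hC, Finset.mem_union, Finset.mem_biUnion]
    exact Or.inr ⟨j, hjmem, by simpa using heE⟩
  set q₁ := q₀.induce Cj hq₀supp with hq₁
  have hq₁edges : ∀ e ∈ q₁.edges, Sym2.map Subtype.val e ∉ (↑(E j) : Set (Sym2 (Site d))) :=
    fun e he => hq₀edges _ (map_val_mem_edges_of_mem_edges_induce q₀ hq₀supp e he)
  exact (hE j) α.1 hαlo β.1 hβup (mem_openConnIn_diff_of_walk q₁ hq₁edges)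

end Literature.Probability.Percolation
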